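import Literature.MathematicalPhysics.QuantumManyBody.PeriodicBoseGasImpurity
import Literature.MathematicalPhysics.QuantumManyBody.PeriodicBoseGasEq317
import HarnessLib

/-!
# The pinned scatterer on the torus: translation invariance and the one-boson value

Topic `Literature/MathematicalPhysics/QuantumManyBody`, companion of `PeriodicBoseGasImpurity.lean`
(item `defn-impurityPeriodicEnergy`, route `BECImpurityMassFlow`). That file is kept
import-light; this one adds the API that needs the fundamental-domain shift
`lintegral_cellN_comp_add` of `PeriodicBoseGasEq317.lean` (`[0,L)^{3N}` and all its translates are
fundamental domains of `(Lℤ³)^N`, Mathlib's `ZSpan.isAddFundamentalDomain`) and the tiling lemma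
`tsum_lintegral_cell_sub_latticeVec` of `PeriodicBoseGasLemma32.lean`:

* `PeriodicTrialState.exists_translate Φ t` — the translated state `X ↦ Φ(X - t𝟙)` (all bosons
  moved by `t ∈ ℝ³`) is again an admissible periodic trial state: `C¹`, periodic, Bose-symmetric
  and normalised on the cell (`PeriodicTrialState.lintegral_cellN_comp_sub`: cell integrals of
  periodic integrands are translation invariant; for `N ≥ 1` a trial state forces `0 < L`,
  `PeriodicTrialState.side_pos`). Stated as an existence theorem (this file is theorem-only), to be
  consumed with `obtain ⟨Ψ, hΨ⟩ := Φ.exists_translate t`.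
* `periodicEnergy_translate`: `⟨Φ(· - t𝟙), H Φ(· - t𝟙)⟩ = ⟨Φ, HΦ⟩` — translation invariance of
  Fournais's torus Hamiltonian [Fournais2020, (1.1)].
* `impurityPeriodicEnergy_translate`: moving the scatterer AND the bosons by `t` changes nothing;
  hence **`impurityPeriodicGroundStateEnergy_add_const`**: `E_imp(N, L, x + t) = E_imp(N, L, x)` for
  every `t ∈ ℝ³` — the pinned-scatterer ground-state energy does not depend on where the scatterer
  is pinned (`impurityPeriodicGroundStateEnergy_eq_of_position`), which reduces the "for all
  positions `x`" of items stmt-AtomisticToContinuum-3906/3909 to `x = 0`.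
* `lintegral_cell_periodizedPotential_sub`: the unfolding identity
  `∫_{[0,L)³} v^per(y - x) dy = ∫_{ℝ³} v(|y|) dy`, and the **one-boson value**
  `impurityPeriodicEnergy_const`: on the constant state `Φ ≡ L^{-3/2}` (`N = 1`) the scatterer costs
  exactly `L⁻³ ∫_{ℝ³} v(|y|) dy` (mean field), so `E_imp(1, L, x) ≤ L⁻³ ∫ v`
  (`impurityPeriodicGroundStateEnergy_one_le`; non-vacuity for integrable `v`).

## References

* [Fournais2020] S. Fournais, *Length scales for BEC in the dilute Bose gas*, arXiv:2011.00309,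
  EMS Ser. Congr. Rep. 18 (2021): (1.1)–(1.2) (torus `ℝ³/Lℤ³`, `v^per`, `E(N, L)`).
* [GuentherEtAl2021] N.-E. Guenther, R. Schmidt, G. M. Bruun, V. Gurarie, P. Massignan, *Mobile
  impurity in a Bose–Einstein condensate and the orthogonality catastrophe*, Phys. Rev. A 103,
  013317 (2021), arXiv:2004.07166: eq. (4), static limit `m_I = ∞`.
-/

noncomputable section

open MeasureTheory
open scoped ENNReal NNReal

namespace Literature.MathematicalPhysics.QuantumManyBody.BoseGas

variable {N : ℕ} {L : ℝ}

/-! ### Boxes of non-positive side carry no states -/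

/-- For `L ≤ 0` the cell `[0,L)³` is empty. [folklore] -/
theorem cell_eq_empty (hL : L ≤ 0) : cell L = ∅ :=
  Set.eq_empty_iff_forall_notMem.2 fun x hx => by
    have h := hx 0
    rw [Set.mem_Ico] at h
    linarith [h.1, h.2]

/-- For `L ≤ 0` and `N ≥ 1` the `N`-particle cell is empty. [folklore] -/
theorem cellN_succ_eq_empty (hL : L ≤ 0) (N : ℕ) : cellN (N + 1) L = ∅ :=
  Set.eq_empty_iff_forall_notMem.2 fun X hX => by
    have h := hX 0
    rw [cell_eq_empty hL] at h
    exact h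

/-- A periodic trial state with at least one particle lives on a torus of positive side (its
normalisation `∫_{[0,L)^{3N}} |Φ|² = 1` is impossible on an empty cell). [folklore] -/
theorem PeriodicTrialState.side_pos (Φ : PeriodicTrialState (N + 1) L) : 0 < L := by
  by_contra h
  have h1 := Φ.norm_eq
  rw [cellN_succ_eq_empty (not_lt.mp h) N, Measure.restrict_empty, lintegral_zero_measure] at h1
  exact zero_ne_one h1

/-- **Shift of the fundamental cell, hypothesis-free form**: in the presence of a trial state
(which forces `0 < L` unless `N = 0`, where everything is trivial), cell integrals of integrands
periodic in every particle and axis are invariant under any translation `T` of `(ℝ³)^N`.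
[folklore] -/
theorem PeriodicTrialState.lintegral_cellN_comp_sub (Φ : PeriodicTrialState N L)
    {G : Config N → ℝ≥0∞}
    (hG : ∀ (X : Config N) (i : Fin N) (k : Fin 3),
      G (X + Pi.single i (EuclideanSpace.single k L)) = G X)
    (T : Config N) : ∫⁻ X in cellN N L, G (X - T) = ∫⁻ X in cellN N L, G X := by
  cases N with
  | zero => exact lintegral_congr fun X => by rw [Subsingleton.elim (X - T) X]
  | succ n =>
      have h := lintegral_cellN_comp_add Φ.side_pos hG (-T)
      simpa only [← sub_eq_add_neg] using h

/-! ### Translating all bosons -/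

/-- The kinetic density commutes with translations: `|∇(ψ(· - T))|²(X) = |∇ψ|²(X - T)`.
[folklore] -/
theorem kineticDensity_comp_sub_const (ψ : Config N → ℂ) (T X : Config N) :
    kineticDensity (fun Y => ψ (Y - T)) X = kineticDensity ψ (X - T) := by
  simp only [kineticDensity, fderiv_comp_sub]

/-- The kinetic density of a periodic state is periodic in every particle and axis. [folklore] -/
theorem PeriodicTrialState.kineticDensity_add_single (Φ : PeriodicTrialState N L) (X : Config N)
    (i : Fin N) (k : Fin 3) :
    kineticDensity Φ.ψ (X + Pi.single i (EuclideanSpace.single k L)) = kineticDensity Φ.ψ X := by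
  have h : (fun Y => Φ.ψ (Y + Pi.single i (EuclideanSpace.single k L))) = Φ.ψ :=
    funext fun Y => Φ.periodic Y i k
  conv_rhs => rw [← h]
  simp only [kineticDensity, fderiv_comp_add_right]

/-- The periodic pair interaction is periodic in every particle and axis. [cite: Fournais2020, (1.1)] -/
theorem periodicInteraction_add_single (v : ℝ → ℝ≥0∞) (L : ℝ) (X : Config N) (i : Fin N)
    (k : Fin 3) :
    periodicInteraction v L (X + Pi.single i (EuclideanSpace.single k L)) =
      periodicInteraction v L X := by
  unfold periodicInteraction
  refine Finset.sum_congr rfl fun a _ => Finset.sum_congr rfl fun b _ => ?_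
  obtain ⟨m, hm⟩ := exists_apply_add_single X i k L a
  obtain ⟨n, hn⟩ := exists_apply_add_single X i k L b
  rw [hm, hn, show X a + latticeVec L m - (X b + latticeVec L n) =
      X a - X b + latticeVec L (m - n) by rw [latticeVec_sub]; abel,
    periodizedPotential_add_latticeVec]

/-- **Translation of a periodic trial state**: `(τ_t Φ)(x₁, …, x_N) = Φ(x₁ - t, …, x_N - t)`, all
bosons moved by the same `t ∈ ℝ³`, is again an admissible periodic trial state — `C¹`,
`Lℤ³`-periodic in every particle, Bose-symmetric, and normalised on the cell (the cell integral of
the periodic function `|Φ|²` is translation invariant). [folklore] -/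
theorem PeriodicTrialState.exists_translate (Φ : PeriodicTrialState N L) (t : Space) :
    ∃ Ψ : PeriodicTrialState N L, Ψ.ψ = fun X => Φ.ψ (X - fun _ => t) := by
  refine ⟨{ ψ := fun X => Φ.ψ (X - fun _ => t)
            contDiff := Φ.contDiff.comp (contDiff_id.sub contDiff_const)
            periodic := fun X i k => ?_
            symm := fun σ X => ?_
            norm_eq := ?_ }, rfl⟩
  · show Φ.ψ (X + Pi.single i (EuclideanSpace.single k L) - fun _ => t) = Φ.ψ (X - fun _ => t)
    rw [add_sub_right_comm, Φ.periodic]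
  · show Φ.ψ ((X ∘ σ) - fun _ => t) = Φ.ψ (X - fun _ => t)
    have h : ((X ∘ σ) - fun _ => t) = (X - fun _ => t) ∘ σ := funext fun _ => rfl
    rw [h]
    exact Φ.symm σ _
  · show ∫⁻ X in cellN N L, (‖Φ.ψ (X - fun _ => t)‖₊ : ℝ≥0∞) ^ 2 = 1
    rw [Φ.lintegral_cellN_comp_sub (G := fun X => (‖Φ.ψ X‖₊ : ℝ≥0∞) ^ 2)
      (fun X i k => by simp only [Φ.periodic]) fun _ => t]
    exact Φ.norm_eq

/-- **Translation invariance of the torus Hamiltonian**: `⟨τ_t Φ, H τ_t Φ⟩ = ⟨Φ, H Φ⟩` for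
`H = ∑ⱼ -Δⱼ^per + ∑_{j<k} v^per(xⱼ - x_k)`. [cite: Fournais2020, (1.1)] -/
theorem periodicEnergy_translate (v : ℝ → ℝ≥0∞) (Φ : PeriodicTrialState N L) (t : Space)
    {Ψ : PeriodicTrialState N L} (hΨ : Ψ.ψ = fun X => Φ.ψ (X - fun _ => t)) :
    periodicEnergy v Ψ = periodicEnergy v Φ := by
  unfold periodicEnergy
  rw [hΨ]
  set G : Config N → ℝ≥0∞ := fun X =>
    kineticDensity Φ.ψ X + periodicInteraction v L X * (‖Φ.ψ X‖₊ : ℝ≥0∞) ^ 2 with hG_def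
  have hG : ∀ (X : Config N) (i : Fin N) (k : Fin 3),
      G (X + Pi.single i (EuclideanSpace.single k L)) = G X := fun X i k => by
    simp only [hG_def, Φ.kineticDensity_add_single, periodicInteraction_add_single, Φ.periodic]
  calc ∫⁻ X in cellN N L, kineticDensity (fun Y => Φ.ψ (Y - fun _ => t)) X +
          periodicInteraction v L X * (‖(fun Y => Φ.ψ (Y - fun _ => t)) X‖₊ : ℝ≥0∞) ^ 2
      = ∫⁻ X in cellN N L, G (X - fun _ => t) := lintegral_congr fun X => by
          simp only [hG_def, kineticDensity_comp_sub_const]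
          rw [← periodicInteraction_add_const v L (X - fun _ => t) t, sub_add_cancel]
    _ = ∫⁻ X in cellN N L, G X := Φ.lintegral_cellN_comp_sub hG _

/-- **Joint translation invariance**: moving the scatterer and all bosons by the same `t` leaves
the pinned-scatterer energy unchanged,
`impurityPeriodicEnergy v (x + t) (τ_t Φ) = impurityPeriodicEnergy v x Φ`. [folklore] -/
theorem impurityPeriodicEnergy_translate (v : ℝ → ℝ≥0∞) (x : Space) (Φ : PeriodicTrialState N L)
    (t : Space) {Ψ : PeriodicTrialState N L} (hΨ : Ψ.ψ = fun X => Φ.ψ (X - fun _ => t)) :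
    impurityPeriodicEnergy v (x + t) Ψ = impurityPeriodicEnergy v x Φ := by
  rw [impurityPeriodicEnergy_eq, impurityPeriodicEnergy_eq, periodicEnergy_translate v Φ t hΨ, hΨ]
  congr 1
  set G : Config N → ℝ≥0∞ := fun X =>
    impurityInteraction v L x X * (‖Φ.ψ X‖₊ : ℝ≥0∞) ^ 2 with hG_def
  have hG : ∀ (X : Config N) (i : Fin N) (k : Fin 3),
      G (X + Pi.single i (EuclideanSpace.single k L)) = G X := fun X i k => by
    simp only [hG_def, impurityInteraction_add_single, Φ.periodic]
  calc ∫⁻ X in cellN N L, impurityInteraction v L (x + t) X *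
          (‖(fun Y => Φ.ψ (Y - fun _ => t)) X‖₊ : ℝ≥0∞) ^ 2
      = ∫⁻ X in cellN N L, G (X - fun _ => t) := lintegral_congr fun X => by
          simp only [hG_def]
          rw [← impurityInteraction_add_const v L x (X - fun _ => t) t, sub_add_cancel]
    _ = ∫⁻ X in cellN N L, G X := Φ.lintegral_cellN_comp_sub hG _

/-- **The pinned-scatterer ground-state energy does not depend on the pinning point**:
`E_imp(N, L, x + t) = E_imp(N, L, x)` for every `t ∈ ℝ³` (translate the bosons along).
[folklore] -/
theorem impurityPeriodicGroundStateEnergy_add_const (v : ℝ → ℝ≥0∞) (N : ℕ) (L : ℝ) (x t : Space) :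
    impurityPeriodicGroundStateEnergy v N L (x + t) = impurityPeriodicGroundStateEnergy v N L x := by
  refine le_antisymm (le_iInf fun Φ => ?_) (le_iInf fun Φ => ?_)
  · obtain ⟨Ψ, hΨ⟩ := Φ.exists_translate t
    calc impurityPeriodicGroundStateEnergy v N L (x + t)
        ≤ impurityPeriodicEnergy v (x + t) Ψ := iInf_le _ _
      _ = impurityPeriodicEnergy v x Φ := impurityPeriodicEnergy_translate v x Φ t hΨ
  · obtain ⟨Ψ, hΨ⟩ := Φ.exists_translate (-t)
    calc impurityPeriodicGroundStateEnergy v N L x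
        = impurityPeriodicGroundStateEnergy v N L (x + t + -t) := by rw [add_neg_cancel_right]
      _ ≤ impurityPeriodicEnergy v (x + t + -t) Ψ := iInf_le _ _
      _ = impurityPeriodicEnergy v (x + t) Φ := impurityPeriodicEnergy_translate v (x + t) Φ (-t) hΨ

/-- `E_imp(N, L, x) = E_imp(N, L, y)` for all scatterer positions `x, y`. [folklore] -/
theorem impurityPeriodicGroundStateEnergy_eq_of_position (v : ℝ → ℝ≥0∞) (N : ℕ) (L : ℝ)
    (x y : Space) :
    impurityPeriodicGroundStateEnergy v N L x = impurityPeriodicGroundStateEnergy v N L y := by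
  rw [← impurityPeriodicGroundStateEnergy_add_const v N L x (y - x), add_sub_cancel]

/-! ### The one-boson value on the constant state -/

/-- `∫_{[0,L)^{3·1}} g(x₁) dX = ∫_{[0,L)³} g(y) dy` (one particle). [folklore] -/
theorem lintegral_cellN_one (L : ℝ) (g : Space → ℝ≥0∞) :
    ∫⁻ X in cellN 1 L, g (X 0) = ∫⁻ y in cell L, g y := by
  have hpre : cellN 1 L = (MeasurableEquiv.funUnique (Fin 1) Space) ⁻¹' cell L := by
    ext X
    constructor
    · intro h
      exact h 0
    · intro h i
      rw [Subsingleton.elim i 0]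
      exact h
  rw [hpre]
  exact (volume_preserving_funUnique (Fin 1) Space).setLIntegral_comp_preimage_emb
    (MeasurableEquiv.funUnique (Fin 1) Space).measurableEmbedding g (cell L)

/-- **Unfolding the periodisation**: `∫_{[0,L)³} v^per(y - x) dy = ∫_{ℝ³} v(|y|) dy` for every
`x ∈ ℝ³` (`[0,L)³` tiles `ℝ³` under `Lℤ³`, and Lebesgue measure is translation invariant).
[cite: Fournais2020, (1.1)] -/
theorem lintegral_cell_periodizedPotential_sub (hL : 0 < L) {v : ℝ → ℝ≥0∞} (hv : Measurable v)
    (x : Space) : ∫⁻ y in cell L, periodizedPotential v L (y - x) = ∫⁻ y : Space, v ‖y‖ := by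
  unfold periodizedPotential
  rw [lintegral_tsum (f := fun (n : Fin 3 → ℤ) (y : Space) => v ‖y - x - latticeVec L n‖)
    fun n => ((hv.comp measurable_norm).comp
      ((measurable_id.sub_const x).sub_const (latticeVec L n))).aemeasurable]
  have h1 : ∀ n : Fin 3 → ℤ, (fun y : Space => v ‖y - x - latticeVec L n‖) =
      fun y => (fun u => v ‖u - x‖) (y - latticeVec L n) := by
    intro n; funext y; simp only [sub_right_comm]
  simp_rw [h1]
  rw [tsum_lintegral_cell_sub_latticeVec hL fun u => v ‖u - x‖,
    lintegral_sub_right_eq_self (μ := (volume : Measure Space)) (fun u => v ‖u‖) x]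

/-- **One boson on the constant state**: for `N = 1` and `Φ ≡ L^{-3/2}` the scatterer costs exactly
the mean-field energy `L⁻³ ∫_{ℝ³} v(|y|) dy` (and there is no kinetic or pair energy), whatever the
pinning point. [folklore] -/
theorem impurityPeriodicEnergy_const (hL : 0 < L) {v : ℝ → ℝ≥0∞} (hv : Measurable v) (x : Space) :
    impurityPeriodicEnergy v x (PeriodicTrialState.const hL) =
      (ENNReal.ofReal (L ^ 3))⁻¹ * ∫⁻ y : Space, v ‖y‖ := by
  have hL3 : 0 < L ^ 3 := by positivity
  have hψ : ∀ X, (PeriodicTrialState.const hL).ψ X = ((Real.sqrt (L ^ 3))⁻¹ : ℂ) := fun _ => rfl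
  have hc : ((‖((Real.sqrt (L ^ 3))⁻¹ : ℂ)‖₊ : ℝ≥0∞) ^ 2) = (ENNReal.ofReal (L ^ 3))⁻¹ := by
    rw [← ENNReal.ofReal_inv_of_pos hL3, ← ENNReal.coe_pow, ENNReal.ofReal, ENNReal.coe_inj]
    ext
    rw [NNReal.coe_pow, coe_nnnorm, norm_inv, Complex.norm_real,
      Real.norm_of_nonneg (Real.sqrt_nonneg _), inv_pow, Real.sq_sqrt hL3.le,
      Real.coe_toNNReal _ (by positivity)]
  have hr : (ENNReal.ofReal (L ^ 3))⁻¹ ≠ ⊤ := ENNReal.inv_ne_top.2 (ENNReal.ofReal_pos.2 hL3).ne'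
  have hkin : periodicEnergy v (PeriodicTrialState.const hL) = 0 := by
    refine (lintegral_congr fun X => ?_).trans lintegral_zero
    simp [PeriodicTrialState.const, kineticDensity, periodicInteraction]
  rw [impurityPeriodicEnergy_def, hkin, zero_add]
  calc ∫⁻ X in cellN 1 L, (∑ j : Fin 1, periodizedPotential v L (X j - x)) *
          (‖(PeriodicTrialState.const hL).ψ X‖₊ : ℝ≥0∞) ^ 2
      = ∫⁻ X in cellN 1 L, periodizedPotential v L (X 0 - x) * (ENNReal.ofReal (L ^ 3))⁻¹ :=
        lintegral_congr fun X => by rw [Fin.sum_univ_one, hψ, hc]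
    _ = (∫⁻ X in cellN 1 L, periodizedPotential v L (X 0 - x)) * (ENNReal.ofReal (L ^ 3))⁻¹ :=
        lintegral_mul_const' _ _ hr
    _ = (∫⁻ y in cell L, periodizedPotential v L (y - x)) * (ENNReal.ofReal (L ^ 3))⁻¹ := by
        rw [lintegral_cellN_one L fun y => periodizedPotential v L (y - x)]
    _ = (ENNReal.ofReal (L ^ 3))⁻¹ * ∫⁻ y : Space, v ‖y‖ := by
        rw [lintegral_cell_periodizedPotential_sub hL hv x, mul_comm]

/-- **Non-vacuity**: `E_imp(1, L, x) ≤ L⁻³ ∫_{ℝ³} v(|y|) dy`, finite for integrable `v`. [folklore] -/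
theorem impurityPeriodicGroundStateEnergy_one_le (hL : 0 < L) {v : ℝ → ℝ≥0∞} (hv : Measurable v)
    (x : Space) :
    impurityPeriodicGroundStateEnergy v 1 L x ≤ (ENNReal.ofReal (L ^ 3))⁻¹ * ∫⁻ y : Space, v ‖y‖ :=
  (impurityPeriodicGroundStateEnergy_le v x _).trans_eq (impurityPeriodicEnergy_const hL hv x)

end Literature.MathematicalPhysics.QuantumManyBody.BoseGas

end
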